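import Summits.BirchSwinnertonDyer.BirchSwinnertonDyer.Theorems.ManinLocalTwoThreeTwistDefectSqueezeTransport
import Summits.BirchSwinnertonDyer.BirchSwinnertonDyer.Theorems.ManinLocalTwoThreeManinConstantFiftySix
import Summits.BirchSwinnertonDyer.BirchSwinnertonDyer.Theorems.ManinLocalTwoThreeManinConstantSeventyTwo
import Summits.BirchSwinnertonDyer.BirchSwinnertonDyer.Theorems.ManinLocalTwoThreeManinConstantFortyFour
import Summits.BirchSwinnertonDyer.BirchSwinnertonDyer.Theorems.ManinLocalTwoThreeNeronSqueezeOneHundredEight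
import Literature.NumberTheory.EllipticCurves.QuadraticTwistNegOneLFunctionProofs

/-!
# THE DEFECT LAW OF THE TWIST GROUPOID, part 5: 71.I LEVEL-FREE SQUEEZE TRANSPORT from a root form of level `M ∣ N`, and 71.J squeeze
transport along a `χ₋₄`-twist (cell bsd-f2-manin, desc g46 MEMO-desc §71 §9–§10, TURNKEY T-desc-58 FINAL sha16 ea245f8823aa6498; landed by p1 gen 25)

§9 (E-desc-242): 71.H with the root form at level `M ∣ N` (`charTwist N hMN hmN hχ f₀ ∈ S₂(Γ₀(N))`) — member classes become certifiable
WITHOUT a parametrisation of the high level and without any datum on the root (`abs_maninConstant_eq_one_of_squeeze_charTwist_aligned_level`,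
`…_twoTwist_aligned_level`); §10 (E-desc-243): the same along a `χ₋₄`-twist (`d = −1`, `16 ∣ N`;
`abs_maninConstant_eq_one_of_squeeze_charTwist_aligned_of_half`, `…_negOneTwist_aligned_level`).  The family predicates
`SqueezeTransportTwoTwistFrom` / `SqueezeTransportNegOneTwistFrom` and their instances are in part 7 (`…TwistDefectRootDatum`).  No named fact; C2, Manin's conjecture and BSD NOT proved.
[cite: Stevens1989, Lemma (5.2) p. 96, Lemma (5.4) p. 97, (5.6)–(5.7) p. 98] [cite: Pal2012, Prop. 2.4, Lemma 3.1]
[cite: Connell1999, §5.7.3] [cite: SilvermanAEC2009, Cor. VII.7.2, §C.16] [cite: SilvermanATAEC1994, Cor. IV.9.1] [cite: EdixhovenManin1991, Prop. 2]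
-/

set_option autoImplicit false
-- the summit-side namespace `Summit.BirchSwinnertonDyer.BirchSwinnertonDyer.…` is the tree's (summit = sub-problem)
set_option linter.dupNamespace false

noncomputable section

open scoped Classical NumberField MatrixGroups ModularForm

namespace Summit.BirchSwinnertonDyer.BirchSwinnertonDyer.Theorems.ManinLocalTwoThree.TwistDefect

open WeierstrassCurve CongruenceSubgroup IsDedekindDomain IsDedekindDomain.HeightOneSpectrum Rat.HeightOneSpectrum
  Literature.NumberTheory.Automorphic Literature.NumberTheory.EllipticCurves Literature.NumberTheory.EllipticCurves.ModularForms
  Literature.NumberTheory.LFunctions.PrimitiveQuadratic Summit.BirchSwinnertonDyer.BirchSwinnertonDyer.Theorems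
  Summit.BirchSwinnertonDyer.BirchSwinnertonDyer.Theorems.ManinLocalTwoThree Summit.BirchSwinnertonDyer.Rank1Residual.ManinAdditive
  Summit.BirchSwinnertonDyer.BirchSwinnertonDyer.Theorems.ManinLocalTwoThree.TwistFamilies
  Summit.BirchSwinnertonDyer.BirchSwinnertonDyer.Theorems.ManinLocalTwoThree.AdditiveTwistFamilies

/-! ## §9 71.I  LEVEL-FREE SQUEEZE TRANSPORT — root form of level `M ∣ N` (E-desc-242)

The census (orbit_members_v4_r108.tsv) shows that EVERY `±8`-edge from an additive-at-2 root of level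
`M` with `v₂(M) ≤ 5` climbs to `v₂ = 6` and is ALIGNED (`r = 1`): `24a, 48a → 192c/d`, `20a, 40a, 80a/b →
320a/b/c/f`, `56a/b → 448a/b/e/h`, `36a, 72a → 576a/d/e/i`, `44a → 704d/f`, `52a → 832d/h`,
`108a → 1728f/m`.  p3's explicit squeezes exist in the tree at the roots `20, 24, 40, 44, 48, 56A/B, 72,
96, 108, 144A` (`periodLatticeLe_<level>`).  71.I = 71.H with the root form at level `M ∣ N`
(`charTwist N hMN hmN hχ f₀ ∈ S₂(Γ₀(N))`): the member classes above become certifiable WITHOUT a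
parametrisation of levels `192 … 1728` and without any datum on the root. -/

/-- **71.I-core (root level `M ∣ N`).** [cite: Stevens1989, Lemma (5.4) p. 97] [cite: Pal2012, Lemma 3.1]
[cite: AgasheRibetStein2006, §§1–2] -/
theorem abs_maninConstant_eq_one_of_squeeze_charTwist_aligned_level
    {M : ℕ} [NeZero M] (h4M : 4 ∣ M) {N : ℕ} [NeZero N] (h4N : 4 ∣ N) (hMN : M ∣ N)
    {m : ℕ} [NeZero m] (hmN : m ^ 2 ∣ N)
    {χ : DirichletCharacter ℂ m} (hχq : χ.IsQuadratic) (hχp : χ.IsPrimitive) {d : ℤ} (hd : d ≠ 0)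
    (hG : gaussSum χ (ZMod.stdAddChar (N := m)) ^ 2 = ((4 * d : ℤ) : ℂ))
    (f₀ : CuspForm (Gamma0 M) 2)
    (hsumOf : (∀ x : ℚ, modularSymbol f₀ (x + 1 / 2) = -modularSymbol f₀ x) →
      ∀ x : ℚ, ∃ (u₁ u₂ : ZMod m) (ε : ℤ),
        ∑ v : ZMod m, χ v * modularSymbol f₀ (x + twistShift v) =
          2 * (modularSymbol f₀ (x + twistShift u₁) + ε * modularSymbol f₀ (x + twistShift u₂)))
    (hχeven : ∀ n : ℕ, 2 ∣ n → χ n = 0)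
    (W₀ : WeierstrassCurve ℚ) [W₀.IsElliptic] (L₀ : PeriodPair) (hL₀ : IsNeronLatticeOf (W₀.baseChange ℂ) L₀)
    (hS0 : ∀ z ∈ periodLattice f₀, z ∈ L₀.lattice)
    (heven : ∀ n : ℕ, 2 ∣ n → cuspCoeff f₀ n = 0)
    {C : WeierstrassCurve ℚ} [C.IsElliptic] [C.IsGloballyMinimal] (u : VariableChange ℚ)
    (hu : u • W₀.quadraticTwist (d : ℚ) = C) {r : ℤ} (hr : r = 1 ∨ r = -1)
    (hΔ : (r : ℚ) ^ 12 * C.Δ = (d : ℚ) ^ 6 * W₀.Δ)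
    (W : WeierstrassCurve ℚ) [W.IsElliptic] [W.IsGloballyMinimal] (D : ModularParametrizationData W N)
    (hf : ∀ n : ℕ, ¬ 2 ∣ n → cuspCoeff D.f n = χ n * cuspCoeff f₀ n)
    (hopt : ∀ z ∈ D.L.lattice, ∃ w ∈ periodLattice D.f, z = D.c * w) :
    |D.maninConstant| = 1 := by
  haveI : Fact (Nat.Prime 2) := ⟨Nat.prime_two⟩
  have hd0 : (d : ℚ) ≠ 0 := by exact_mod_cast hd
  haveI : (W₀.quadraticTwist (d : ℚ)).IsElliptic := W₀.isElliptic_quadraticTwist hd0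
  set s : ℂ := gaussSum χ (ZMod.stdAddChar (N := m)) / 2 with hs
  have hs2 : s ^ 2 = ((d : ℚ) : ℂ) := by
    rw [hs, div_pow, hG]
    push_cast
    ring
  have hhalf : ∀ x : ℚ, modularSymbol f₀ (x + 1 / 2) = -modularSymbol f₀ x :=
    maninLocalTwoThree_modularSymbol_add_half_eq_neg_of_four_dvd f₀ h4M heven
  have hstep : ∀ w ∈ periodLattice (charTwist N hMN hmN hχq f₀), s * w ∈ periodLattice f₀ :=
    fun w hw ↦ half_gaussSum_mul_mem_periodLattice_of_mem_charTwist N hMN hmN hχq hχp f₀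
      (hsumOf hhalf) hw
  have hadd : ¬ W.HasGoodReductionAtPrime 2 ∧ ¬ W.HasMultiplicativeReductionAtPrime 2 :=
    KatoCurve.additive_of_sq_dvd_level 2 W D.f D.isNewformOf
      (by rw [show (2 : ℕ) ^ 2 = 4 by norm_num]; exact h4N)
  have hfD : D.f = charTwist N hMN hmN hχq f₀ :=
    eq_of_forall_cuspCoeff_eq_gamma0 fun n ↦ by
      rw [cuspCoeff_charTwist N hMN hmN hχq hχp]
      by_cases h2n : 2 ∣ n
      · rw [D.isNewformOf.2 n, W.LFunction_apply_eq_zero_of_not_good_of_not_mult 2 hadd.1 hadd.2 h2n,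
          hχeven n h2n]
        simp
      · exact hf n h2n
  obtain ⟨LC, hC⟩ := exists_isNeronLatticeOf_holds (C.baseChange ℂ)
  have hS2 : ∀ z ∈ periodLattice D.f, z ∈ LC.lattice := by
    intro z hz
    rw [hfD] at hz
    have h1 : s * z ∈ L₀.lattice := hS0 _ (hstep z hz)
    rcases hr with rfl | rfl
    · rw [neronLattice_mem_iff_of_twist_of_sq_eq hd0 u hu hΔ hs2 hL₀ hC]
      convert h1 using 1
      push_cast
      ring
    · rw [neronLattice_mem_iff_of_twist_of_sq_eq hd0 u hu hΔ hs2 hL₀ hC]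
      convert neg_mem h1 using 1
      push_cast
      ring
  exact NeronSqueeze.abs_maninConstant_eq_one_of_periodLattice_le C LC hC W D hS2 hopt

/-- **71.I  LEVEL-FREE SQUEEZE TRANSPORT ALONG AN ALIGNED `±8`-TWIST** (root form `φ₀ ∈ S₂(Γ₀(M))`,
`4 ∣ M`, `M ∣ N`, `64 ∣ N`).  USE: `M = 24, N = 192` (`192c/d` from p3's `periodLatticeLe_twentyFour`),
`(20|40, 320)`, `(56, 448)`, `(72, 576)`, `(44, 704)`, `(108, 1728)`, `(96, 192)`, `(144, 576)`, `(128, 128)`.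
[cite: Stevens1989, Lemma (5.4) p. 97] [cite: Pal2012, Prop. 2.4, Lemma 3.1] [cite: AgasheRibetStein2006, §§1–2] -/
theorem abs_maninConstant_eq_one_of_squeeze_twoTwist_aligned_level {d : ℤ} (hd : d = 2 ∨ d = -2)
    {M : ℕ} [NeZero M] (h4M : 4 ∣ M) {N : ℕ} [NeZero N] (hMN : M ∣ N) (h64N : 8 ^ 2 ∣ N)
    (f₀ : CuspForm (Gamma0 M) 2)
    (W₀ : WeierstrassCurve ℚ) [W₀.IsElliptic] (L₀ : PeriodPair) (hL₀ : IsNeronLatticeOf (W₀.baseChange ℂ) L₀)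
    (hS0 : ∀ z ∈ periodLattice f₀, z ∈ L₀.lattice)
    (heven : ∀ n : ℕ, 2 ∣ n → cuspCoeff f₀ n = 0)
    {C : WeierstrassCurve ℚ} [C.IsElliptic] [C.IsGloballyMinimal] (u : VariableChange ℚ)
    (hu : u • W₀.quadraticTwist (d : ℚ) = C) {r : ℤ} (hr : r = 1 ∨ r = -1)
    (hΔ : (r : ℚ) ^ 12 * C.Δ = (d : ℚ) ^ 6 * W₀.Δ)
    (W : WeierstrassCurve ℚ) [W.IsElliptic] [W.IsGloballyMinimal] (D : ModularParametrizationData W N)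
    (hf : ∀ n : ℕ, ¬ 2 ∣ n →
      cuspCoeff D.f n = ((if d = 2 then ZMod.χ₈ n else ZMod.χ₈' n : ℤ) : ℂ) * cuspCoeff f₀ n)
    (hopt : ∀ z ∈ D.L.lattice, ∃ w ∈ periodLattice D.f, z = D.c * w) :
    |D.maninConstant| = 1 := by
  have hdZ : d ≠ 0 := by rcases hd with rfl | rfl <;> norm_num
  have h4N : 4 ∣ N := dvd_trans ⟨16, by norm_num⟩ h64N
  rcases hd with rfl | rfl
  · exact abs_maninConstant_eq_one_of_squeeze_charTwist_aligned_level h4M h4N hMN h64N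
      isQuadratic_χ₈_ringHomComp isPrimitive_χ₈_ringHomComp hdZ
      (by rw [gaussSum_χ₈_ringHomComp_sq]; norm_num) f₀
      (fun hhalf x ↦ ⟨1, 3, -1, sum_χ₈_modularSymbol_of_half f₀ hhalf x⟩)
      (fun n hn ↦ by
        rw [χ₈_ringHomComp_apply_natCast, ZMod.χ₈_nat_eq_if_mod_eight,
          if_pos (Nat.mod_eq_zero_of_dvd hn)]
        simp)
      W₀ L₀ hL₀ hS0 heven u hu hr hΔ W D
      (fun n hn ↦ by rw [χ₈_ringHomComp_apply_natCast, hf n hn, if_pos rfl]) hopt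
  · exact abs_maninConstant_eq_one_of_squeeze_charTwist_aligned_level h4M h4N hMN h64N
      isQuadratic_χ₈'_ringHomComp isPrimitive_χ₈'_ringHomComp hdZ
      (by rw [gaussSum_χ₈'_ringHomComp_sq]; norm_num) f₀
      (fun hhalf x ↦ ⟨1, 3, 1, sum_χ₈'_modularSymbol_of_half f₀ hhalf x⟩)
      (fun n hn ↦ by
        rw [χ₈'_ringHomComp_apply_natCast, ZMod.χ₈'_nat_eq_if_mod_eight,
          if_pos (Nat.mod_eq_zero_of_dvd hn)]
        simp)
      W₀ L₀ hL₀ hS0 heven u hu hr hΔ W D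
      (fun n hn ↦ by rw [χ₈'_ringHomComp_apply_natCast, hf n hn, if_neg (by norm_num)]) hopt



/-! ## §10 71.J  SQUEEZE TRANSPORT ALONG A `χ₋₄`-TWIST (`d = −1`, `16 ∣ N`) + LEVEL 112 from LEVEL 56 (E-desc-243)

For `d = −1` every edge inside the additive locus is aligned (`|r₁r₂| = |d| = 1`); the census edges with a
tree squeeze at the root: `56a → 112b`, `56b → 112a`, `72a → 144b`, `44a → 176c`, `108a → 432b`,
`128a → 128c` (and `36a → 144a`, `52a → 208c` without one).  Cremona's optimal curves are themselves the
aligned models: `112b1 = [0,0,0,1,−2] = 56a1 ⊗ (−1)`, `112a1 = [0,1,0,0,4] = 56b1 ⊗ (−1)` (`u = 1`,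
`r = 1`).  Level 112 is on the cell's pinning frontier (an g54 T-an-g54-L112). -/

/-- **71.J (generic core with the HALF-TRANSLATE as hypothesis).**  As 71.I-core but assuming the
half-translate symmetry `M_{f₀}(x + ½) = −M_{f₀}(x)` of the root form directly (it is implied by
`a₂ₖ(f₀) = 0` when `4 ∣ M`; for `η`-quotient roots it is also `f₀(τ + ½) = −f₀(τ)`). [cite: Stevens1989, Lemma (5.4) p. 97] -/
theorem abs_maninConstant_eq_one_of_squeeze_charTwist_aligned_of_half
    {M : ℕ} [NeZero M] {N : ℕ} [NeZero N] (h4N : 4 ∣ N) (hMN : M ∣ N)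
    {m : ℕ} [NeZero m] (hmN : m ^ 2 ∣ N)
    {χ : DirichletCharacter ℂ m} (hχq : χ.IsQuadratic) (hχp : χ.IsPrimitive) {d : ℤ} (hd : d ≠ 0)
    (hG : gaussSum χ (ZMod.stdAddChar (N := m)) ^ 2 = ((4 * d : ℤ) : ℂ))
    (f₀ : CuspForm (Gamma0 M) 2)
    (hhalf : ∀ x : ℚ, modularSymbol f₀ (x + 1 / 2) = -modularSymbol f₀ x)
    (hsum : ∀ x : ℚ, ∃ (u₁ u₂ : ZMod m) (ε : ℤ),
        ∑ v : ZMod m, χ v * modularSymbol f₀ (x + twistShift v) =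
          2 * (modularSymbol f₀ (x + twistShift u₁) + ε * modularSymbol f₀ (x + twistShift u₂)))
    (hχeven : ∀ n : ℕ, 2 ∣ n → χ n = 0)
    (W₀ : WeierstrassCurve ℚ) [W₀.IsElliptic] (L₀ : PeriodPair) (hL₀ : IsNeronLatticeOf (W₀.baseChange ℂ) L₀)
    (hS0 : ∀ z ∈ periodLattice f₀, z ∈ L₀.lattice)
    {C : WeierstrassCurve ℚ} [C.IsElliptic] [C.IsGloballyMinimal] (u : VariableChange ℚ)
    (hu : u • W₀.quadraticTwist (d : ℚ) = C) {r : ℤ} (hr : r = 1 ∨ r = -1)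
    (hΔ : (r : ℚ) ^ 12 * C.Δ = (d : ℚ) ^ 6 * W₀.Δ)
    (W : WeierstrassCurve ℚ) [W.IsElliptic] [W.IsGloballyMinimal] (D : ModularParametrizationData W N)
    (hf : ∀ n : ℕ, ¬ 2 ∣ n → cuspCoeff D.f n = χ n * cuspCoeff f₀ n)
    (hopt : ∀ z ∈ D.L.lattice, ∃ w ∈ periodLattice D.f, z = D.c * w) :
    |D.maninConstant| = 1 := by
  haveI : Fact (Nat.Prime 2) := ⟨Nat.prime_two⟩
  have _hh := hhalf
  have hd0 : (d : ℚ) ≠ 0 := by exact_mod_cast hd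
  haveI : (W₀.quadraticTwist (d : ℚ)).IsElliptic := W₀.isElliptic_quadraticTwist hd0
  set s : ℂ := gaussSum χ (ZMod.stdAddChar (N := m)) / 2 with hs
  have hs2 : s ^ 2 = ((d : ℚ) : ℂ) := by
    rw [hs, div_pow, hG]
    push_cast
    ring
  have hstep : ∀ w ∈ periodLattice (charTwist N hMN hmN hχq f₀), s * w ∈ periodLattice f₀ :=
    fun w hw ↦ half_gaussSum_mul_mem_periodLattice_of_mem_charTwist N hMN hmN hχq hχp f₀ hsum hw
  have hadd : ¬ W.HasGoodReductionAtPrime 2 ∧ ¬ W.HasMultiplicativeReductionAtPrime 2 :=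
    KatoCurve.additive_of_sq_dvd_level 2 W D.f D.isNewformOf
      (by rw [show (2 : ℕ) ^ 2 = 4 by norm_num]; exact h4N)
  have hfD : D.f = charTwist N hMN hmN hχq f₀ :=
    eq_of_forall_cuspCoeff_eq_gamma0 fun n ↦ by
      rw [cuspCoeff_charTwist N hMN hmN hχq hχp]
      by_cases h2n : 2 ∣ n
      · rw [D.isNewformOf.2 n, W.LFunction_apply_eq_zero_of_not_good_of_not_mult 2 hadd.1 hadd.2 h2n,
          hχeven n h2n]
        simp
      · exact hf n h2n
  obtain ⟨LC, hC⟩ := exists_isNeronLatticeOf_holds (C.baseChange ℂ)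
  have hS2 : ∀ z ∈ periodLattice D.f, z ∈ LC.lattice := by
    intro z hz
    rw [hfD] at hz
    have h1 : s * z ∈ L₀.lattice := hS0 _ (hstep z hz)
    rcases hr with rfl | rfl
    · rw [neronLattice_mem_iff_of_twist_of_sq_eq hd0 u hu hΔ hs2 hL₀ hC]
      convert h1 using 1
      push_cast
      ring
    · rw [neronLattice_mem_iff_of_twist_of_sq_eq hd0 u hu hΔ hs2 hL₀ hC]
      convert neg_mem h1 using 1
      push_cast
      ring
  exact NeronSqueeze.abs_maninConstant_eq_one_of_periodLattice_le C LC hC W D hS2 hopt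

/-- **71.J  SQUEEZE TRANSPORT ALONG THE `χ₋₄`-TWIST** (root form `φ₀ ∈ S₂(Γ₀(M))`, `4 ∣ M`, `M ∣ N`,
`16 ∣ N`; member `aₙ(f_D) = χ₋₄(n)·aₙ(φ₀)` at odd `n`; aligned model `C = u • (W₀ ⊗ (−1))`, `r = ±1`).
USE: `(56, 112)`: `112a ← 56b`, `112b ← 56a`; `(72, 144)`: `144b`; `(44, 176)`: `176c`; `(108, 432)`: `432b`.
[cite: Stevens1989, Lemma (5.4) p. 97] [cite: Pal2012, Prop. 2.4] [cite: AgasheRibetStein2006, §§1–2] -/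
theorem abs_maninConstant_eq_one_of_squeeze_negOneTwist_aligned_level
    {M : ℕ} [NeZero M] (h4M : 4 ∣ M) {N : ℕ} [NeZero N] (hMN : M ∣ N) (h16N : 4 ^ 2 ∣ N)
    (f₀ : CuspForm (Gamma0 M) 2)
    (W₀ : WeierstrassCurve ℚ) [W₀.IsElliptic] (L₀ : PeriodPair) (hL₀ : IsNeronLatticeOf (W₀.baseChange ℂ) L₀)
    (hS0 : ∀ z ∈ periodLattice f₀, z ∈ L₀.lattice)
    (heven : ∀ n : ℕ, 2 ∣ n → cuspCoeff f₀ n = 0)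
    {C : WeierstrassCurve ℚ} [C.IsElliptic] [C.IsGloballyMinimal] (u : VariableChange ℚ)
    (hu : u • W₀.quadraticTwist (-1) = C) {r : ℤ} (hr : r = 1 ∨ r = -1) (hΔ : (r : ℚ) ^ 12 * C.Δ = W₀.Δ)
    (W : WeierstrassCurve ℚ) [W.IsElliptic] [W.IsGloballyMinimal] (D : ModularParametrizationData W N)
    (hf : ∀ n : ℕ, ¬ 2 ∣ n → cuspCoeff D.f n = (ZMod.χ₄ n : ℂ) * cuspCoeff f₀ n)
    (hopt : ∀ z ∈ D.L.lattice, ∃ w ∈ periodLattice D.f, z = D.c * w) :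
    |D.maninConstant| = 1 := by
  have h4N : 4 ∣ N := dvd_trans ⟨4, by norm_num⟩ h16N
  exact abs_maninConstant_eq_one_of_squeeze_charTwist_aligned_of_half (d := -1) h4N hMN h16N
    isQuadratic_χ₄_ringHomComp isPrimitive_χ₄_ringHomComp (by norm_num)
    (by rw [gaussSum_χ₄_ringHomComp_sq]; norm_num) f₀
    (maninLocalTwoThree_modularSymbol_add_half_eq_neg_of_four_dvd f₀ h4M heven)
    (fun x ↦ ⟨1, 3, 0, sum_χ₄_modularSymbol_of_half f₀
      (maninLocalTwoThree_modularSymbol_add_half_eq_neg_of_four_dvd f₀ h4M heven) x⟩)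
    (fun n hn ↦ by
      rw [χ₄_ringHomComp_apply_natCast, ZMod.χ₄_nat_eq_if_mod_four, if_pos (Nat.mod_eq_zero_of_dvd hn)]
      simp)
    W₀ L₀ hL₀ hS0 u (by exact_mod_cast hu) hr (by rw [hΔ]; norm_num) W D
    (fun n hn ↦ by rw [χ₄_ringHomComp_apply_natCast, hf n hn]) hopt


end Summit.BirchSwinnertonDyer.BirchSwinnertonDyer.Theorems.ManinLocalTwoThree.TwistDefect

end
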